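import Literature.MathematicalPhysics.QuantumLattice.PerronFrobeniusGroundState
import Literature.MathematicalPhysics.QuantumLattice.FinDimSpectrumProofs
import Literature.MathematicalPhysics.QuantumLattice.HubbardWave0
import Literature.MathematicalPhysics.QuantumLattice.FreeFermionSpinTwistedTraceFormula
import HarnessLib

/-!
# The one-body problem: Perron–Frobenius multiplicity one and spin-doubled eigenmodes (band bottom, part 2)

Topic `Literature/MathematicalPhysics/QuantumLattice` (sub-namespace `HubbardBandBottom`). Written for
route `HubbardSuperconductivity/ParityLeeYang`, support `BandBottomOnAxis` (stmt-HubbardSuperconductivity-8386).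

For a Hermitian one-body matrix `A` on the sites `Λ` (later: minus the adjacency matrix of the
torus) we record:

* `groundEnergy_mul_le_rayleigh` — the homogeneous variational bound `E₁ ⟨v,v⟩ ≤ Re ⟨v, A v⟩`;
* `card_filter_eigenvalues_eq_groundEnergy` — under the Perron–Frobenius hypotheses (real
  symmetric, nonpositive off-diagonal entries, connected graph) EXACTLY ONE index of Mathlib's
  eigenvector basis carries the lowest eigenvalue `E₁ = A.groundEnergy`
  (`perronFrobenius_groundState_unique`);
* `exists_gap` — a uniform gap `γ > 0` between `E₁` and every other eigenvalue;
* `spinModes_complete`, `spinModes_orthonormal`, `spinModes_eigen` (orbital sums via the tree's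
  `sum_orb_eq_sum_sum`) — the spin-doubled family
  `u_{(k,σ)}(x,τ) = [τ = σ] U_{xk}` (`U` = `eigenvectorUnitary`) is a complete orthonormal family
  of eigenmodes of any orbital matrix `h` with `h_{(x,σ),(y,τ)} = [σ = τ] A_{xy}`.

Everything is proved; no definitions (the families are passed as hypotheses `hu : ∀ κ o, u κ o = …`).
Sources: Lieb–Wu, Physica A 321 (2003) 1, §2 (Perron–Frobenius for lattice Hamiltonians);
Bratteli–Robinson II §5.2.1.
-/

namespace Literature.MathematicalPhysics.QuantumLattice.HubbardBandBottom

open Matrix Finset Literature.MathematicalPhysics.QuantumLattice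
open scoped ComplexOrder

variable {Λ : Type*} [LinearOrder Λ] [Fintype Λ]

/-- Homogeneous variational bound: `E₁ · Re ⟨v, v⟩ ≤ Re ⟨v, A v⟩` for Hermitian `A`
(`A - E₁ ≥ 0`). [folklore] -/
theorem groundEnergy_mul_le_rayleigh {A : Matrix Λ Λ ℂ} (hA : A.IsHermitian) (v : Λ → ℂ) :
    A.groundEnergy * (star v ⬝ᵥ v).re ≤ (star v ⬝ᵥ A *ᵥ v).re := by
  have h := (posSemidef_sub_groundEnergy hA).dotProduct_mulVec_nonneg v
  rw [sub_mulVec, dotProduct_sub, Algebra.algebraMap_eq_smul_one, smul_mulVec, one_mulVec,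
    dotProduct_smul] at h
  obtain ⟨hre, -⟩ := Complex.nonneg_iff.mp h
  simp only [Complex.sub_re, Complex.real_smul, Complex.mul_re, Complex.ofReal_re,
    Complex.ofReal_im, zero_mul, sub_zero] at hre
  linarith

/-- **Perron–Frobenius, multiplicity one.** For a real symmetric matrix with nonpositive
off-diagonal entries and connected graph, exactly one index of the eigenvector basis carries the
lowest eigenvalue. Lieb–Wu (2003) §2, item 1. [cite: LiebWuPhysicaA2003, §2, item 1] -/
theorem card_filter_eigenvalues_eq_groundEnergy {A : Matrix Λ Λ ℂ} (hA : A.IsHermitian)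
    (hsymm : ∀ i j, A i j = A j i) (hreal : ∀ i j, star (A i j) = A i j)
    (hoff : ∀ i j, i ≠ j → (A i j).re ≤ 0)
    (hconn : ∀ i j, Relation.ReflTransGen (fun a b => A a b ≠ 0) i j) [Nonempty Λ] :
    (Finset.univ.filter fun k => hA.eigenvalues k = A.groundEnergy).card = 1 := by
  classical
  rw [hA.card_filter_eigenvalues_eq]
  change Module.finrank ℂ A.groundSpace = 1
  have hE := groundEnergy_mul_le_rayleigh hA
  apply le_antisymm
  · rw [finrank_le_one_iff]
    obtain ⟨ψ, hψ, hψ0⟩ := (Submodule.ne_bot_iff _).1 (groundSpace_ne_bot_holds hA)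
    refine ⟨⟨ψ, hψ⟩, fun w => ?_⟩
    obtain ⟨c, hc⟩ := perronFrobenius_groundState_unique hsymm hreal hoff hconn hE
      ((mem_groundSpace_iff _ _).1 hψ) ((mem_groundSpace_iff _ _).1 w.2) hψ0
    exact ⟨c, Subtype.ext (by rw [Submodule.coe_smul, hc])⟩
  · exact Nat.one_le_iff_ne_zero.2 fun h0 =>
      groundSpace_ne_bot_holds hA (Submodule.finrank_eq_zero.1 h0)

/-- Every eigenvalue other than the lowest one lies above it by a uniform gap `γ > 0` (finitely
many eigenvalues). [folklore] -/
theorem exists_gap {A : Matrix Λ Λ ℂ} (hA : A.IsHermitian) :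
    ∃ γ : ℝ, 0 < γ ∧ ∀ k, hA.eigenvalues k ≠ A.groundEnergy →
      A.groundEnergy + γ ≤ hA.eigenvalues k := by
  classical
  set T := Finset.univ.filter fun k => hA.eigenvalues k ≠ A.groundEnergy with hT
  by_cases hne : T.Nonempty
  · refine ⟨(T.image fun k => hA.eigenvalues k - A.groundEnergy).min' (hne.image _), ?_, ?_⟩
    · rw [Finset.lt_min'_iff]
      intro y hy
      obtain ⟨k, hk, rfl⟩ := Finset.mem_image.1 hy
      have hk' : hA.eigenvalues k ≠ A.groundEnergy := (Finset.mem_filter.1 hk).2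
      exact sub_pos.2 (lt_of_le_of_ne (groundEnergy_le_eigenvalues hA k) (Ne.symm hk'))
    · intro k hk
      have hmem : hA.eigenvalues k - A.groundEnergy ∈
          T.image fun k => hA.eigenvalues k - A.groundEnergy :=
        Finset.mem_image.2 ⟨k, Finset.mem_filter.2 ⟨Finset.mem_univ _, hk⟩, rfl⟩
      have := Finset.min'_le _ _ hmem
      linarith
  · refine ⟨1, one_pos, fun k hk => ?_⟩
    exact absurd ⟨k, Finset.mem_filter.2 ⟨Finset.mem_univ _, hk⟩⟩ hne

/-- **Completeness of the spin-doubled eigenmodes** `u_{(k,σ)}(x,τ) = [τ = σ] U_{xk}`: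
`Σ_κ u_κ(i) conj (u_κ(j)) = δ_ij` (unitarity `U U⋆ = 1`). [folklore] -/
theorem spinModes_complete {A : Matrix Λ Λ ℂ} (hA : A.IsHermitian) (u : Orb Λ → Orb Λ → ℂ)
    (hu : ∀ κ o, u κ o = if (ofLex o).2 = (ofLex κ).2 then
      (hA.eigenvectorUnitary : Matrix Λ Λ ℂ) (ofLex o).1 (ofLex κ).1 else 0) (i j : Orb Λ) :
    ∑ κ, u κ i * star (u κ j) = if i = j then 1 else 0 := by
  classical
  set U : Matrix Λ Λ ℂ := (hA.eigenvectorUnitary : Matrix Λ Λ ℂ) with hUdef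
  have hU : U * star U = 1 := Matrix.mem_unitaryGroup_iff.1 hA.eigenvectorUnitary.2
  obtain ⟨⟨x, σ⟩, rfl⟩ : ∃ p : Λ × Fin 2, toLex p = i := ⟨ofLex i, toLex_ofLex i⟩
  obtain ⟨⟨y, τ⟩, rfl⟩ : ∃ p : Λ × Fin 2, toLex p = j := ⟨ofLex j, toLex_ofLex j⟩
  rw [sum_orb_eq_sum_sum]
  simp only [hu, orb, ofLex_toLex]
  have key : ∑ k : Λ, ∑ ρ : Fin 2, (if σ = ρ then U x k else 0) * star (if τ = ρ then U y k else 0)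
      = if σ = τ then ∑ k, U x k * star (U y k) else 0 := by
    by_cases hστ : σ = τ
    · subst hστ
      rw [if_pos rfl]
      refine Finset.sum_congr rfl fun k _ => ?_
      rw [Finset.sum_eq_single σ (fun ρ _ hρ => by rw [if_neg (Ne.symm hρ), zero_mul])
        (fun h => absurd (Finset.mem_univ σ) h), if_pos rfl, if_pos rfl]
    · rw [if_neg hστ]
      refine Finset.sum_eq_zero fun k _ => Finset.sum_eq_zero fun ρ _ => ?_
      by_cases h1 : σ = ρ
      · subst h1; rw [if_neg (Ne.symm hστ), star_zero, mul_zero]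
      · rw [if_neg h1, zero_mul]
  rw [key]
  have hentry : ∑ k, U x k * star (U y k) = (U * star U) x y := by
    simp only [Matrix.mul_apply, Matrix.star_apply]
  rw [hentry, hU, Matrix.one_apply]
  by_cases hστ : σ = τ
  · subst hστ
    by_cases hxy : x = y
    · subst hxy; simp
    · rw [if_pos rfl, if_neg hxy, if_neg]
      exact fun h => hxy (congrArg Prod.fst (toLex.injective h))
  · rw [if_neg hστ, if_neg]
    exact fun h => hστ (congrArg Prod.snd (toLex.injective h))

/-- **Orthonormality of the spin-doubled eigenmodes** (`U⋆ U = 1`). [folklore] -/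
theorem spinModes_orthonormal {A : Matrix Λ Λ ℂ} (hA : A.IsHermitian) (u : Orb Λ → Orb Λ → ℂ)
    (hu : ∀ κ o, u κ o = if (ofLex o).2 = (ofLex κ).2 then
      (hA.eigenvectorUnitary : Matrix Λ Λ ℂ) (ofLex o).1 (ofLex κ).1 else 0) (κ κ' : Orb Λ) :
    star (u κ) ⬝ᵥ u κ' = if κ = κ' then 1 else 0 := by
  classical
  set U : Matrix Λ Λ ℂ := (hA.eigenvectorUnitary : Matrix Λ Λ ℂ) with hUdef
  have hU : star U * U = 1 := Matrix.mem_unitaryGroup_iff'.1 hA.eigenvectorUnitary.2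
  obtain ⟨⟨k, σ⟩, rfl⟩ : ∃ p : Λ × Fin 2, toLex p = κ := ⟨ofLex κ, toLex_ofLex κ⟩
  obtain ⟨⟨l, τ⟩, rfl⟩ : ∃ p : Λ × Fin 2, toLex p = κ' := ⟨ofLex κ', toLex_ofLex κ'⟩
  rw [dotProduct, sum_orb_eq_sum_sum]
  simp only [hu, orb, ofLex_toLex, Pi.star_apply]
  have key : ∑ x : Λ, ∑ ρ : Fin 2, star (if ρ = σ then U x k else 0) * (if ρ = τ then U x l else 0)
      = if σ = τ then ∑ x, star (U x k) * U x l else 0 := by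
    by_cases hστ : σ = τ
    · subst hστ
      rw [if_pos rfl]
      refine Finset.sum_congr rfl fun x _ => ?_
      rw [Finset.sum_eq_single σ (fun ρ _ hρ => by rw [if_neg hρ, star_zero, zero_mul])
        (fun h => absurd (Finset.mem_univ σ) h), if_pos rfl, if_pos rfl]
    · rw [if_neg hστ]
      refine Finset.sum_eq_zero fun x _ => Finset.sum_eq_zero fun ρ _ => ?_
      by_cases h1 : ρ = σ
      · subst h1; rw [if_neg hστ, mul_zero]
      · rw [if_neg h1, star_zero, zero_mul]
  rw [key]
  have hentry : ∑ x, star (U x k) * U x l = (star U * U) k l := by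
    simp only [Matrix.mul_apply, Matrix.star_apply]
  rw [hentry, hU, Matrix.one_apply]
  by_cases hστ : σ = τ
  · subst hστ
    by_cases hkl : k = l
    · subst hkl; simp
    · rw [if_pos rfl, if_neg hkl, if_neg]
      exact fun h => hkl (congrArg Prod.fst (toLex.injective h))
  · rw [if_neg hστ, if_neg]
    exact fun h => hστ (congrArg Prod.snd (toLex.injective h))

/-- **The spin-doubled family diagonalises a spin-diagonal orbital matrix**:
`h u_{(k,σ)} = λ_k u_{(k,σ)}` for `h_{(x,σ),(y,τ)} = [σ = τ] A_{xy}`. [folklore] -/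
theorem spinModes_eigen {A : Matrix Λ Λ ℂ} (hA : A.IsHermitian) (h : Matrix (Orb Λ) (Orb Λ) ℂ)
    (hh : ∀ x σ y τ, h (orb x σ) (orb y τ) = if σ = τ then A x y else 0)
    (u : Orb Λ → Orb Λ → ℂ)
    (hu : ∀ κ o, u κ o = if (ofLex o).2 = (ofLex κ).2 then
      (hA.eigenvectorUnitary : Matrix Λ Λ ℂ) (ofLex o).1 (ofLex κ).1 else 0) (κ : Orb Λ) :
    h *ᵥ u κ = ((hA.eigenvalues (ofLex κ).1 : ℝ) : ℂ) • u κ := by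
  classical
  set U : Matrix Λ Λ ℂ := (hA.eigenvectorUnitary : Matrix Λ Λ ℂ) with hUdef
  obtain ⟨⟨k, σ⟩, rfl⟩ : ∃ p : Λ × Fin 2, toLex p = κ := ⟨ofLex κ, toLex_ofLex κ⟩
  -- the site eigenvector equation, entrywise
  have hcol : (fun x => U x k) = ⇑(hA.eigenvectorBasis k) := by
    funext x; rw [hUdef, Matrix.IsHermitian.eigenvectorUnitary_apply]
  have heigA : ∀ x, ∑ y, A x y * U y k = (hA.eigenvalues k : ℂ) * U x k := by
    intro x
    have h1 := congrFun (hA.mulVec_eigenvectorBasis k) x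
    rw [← hcol] at h1
    simp only [mulVec, dotProduct, Pi.smul_apply] at h1
    rw [h1, Complex.real_smul]
  funext o
  obtain ⟨⟨x, τ⟩, rfl⟩ : ∃ p : Λ × Fin 2, toLex p = o := ⟨ofLex o, toLex_ofLex o⟩
  simp only [mulVec, dotProduct, Pi.smul_apply, smul_eq_mul]
  rw [sum_orb_eq_sum_sum]
  simp only [hu, ofLex_toLex]
  have hh' : ∀ y ρ, h (toLex (x, τ)) (orb y ρ) = if τ = ρ then A x y else 0 := fun y ρ => hh x τ y ρ
  simp only [orb] at hh'
  simp only [orb, hh']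
  by_cases hτσ : τ = σ
  · subst hτσ
    rw [if_pos rfl, ← heigA x]
    refine Finset.sum_congr rfl fun y _ => ?_
    rw [Finset.sum_eq_single τ (fun ρ _ hρ => by rw [if_neg (Ne.symm hρ), zero_mul])
      (fun h => absurd (Finset.mem_univ τ) h), if_pos rfl, if_pos rfl]
  · rw [if_neg hτσ, mul_zero]
    refine Finset.sum_eq_zero fun y _ => Finset.sum_eq_zero fun ρ _ => ?_
    by_cases h1 : τ = ρ
    · subst h1; rw [if_neg hτσ, mul_zero]
    · rw [if_neg h1, zero_mul]

end Literature.MathematicalPhysics.QuantumLattice.HubbardBandBottom
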